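import Mathlib
import Summits.Ventures.HodgeRepro.Tier4.Line1.FinLevelCompact

/-!
# Tier4/Line1/TotallyDefiniteCompact — the archimedean image of `U(W)(𝔸_k)` is bounded on a TOTALLY DEFINITE plane, so
`K_f(N) × G(k_∞)` is compact and (S1b) holds for the concrete spherical pairs with NO analytic binder

Blind re-derivation cell `pub-hodge-repro`, Tier 4 (README §9–§10), seat t4-L1-p2 (gen 4), LINE L1.  Target tree path
`lean/Summits/Ventures/HodgeRepro/Tier4/Line1/TotallyDefiniteCompact.lean`.  Imports this seat's `FinLevelCompact`
(`archImage`, `isCompact_finLevel_of_subset`, and through it `ArchMatrixCoeff` / `LeftTypeOfMatrixCoeff`, typer-2's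
`AdelicPlaces` (`adComponentInf`) and `AdelicDefs` (`unitaryGroup`, `adMat`)).

WHAT THIS IS.  `FinLevelCompact` proves the compactness of `K_f(N) × G(k_∞)` from a DISPLAYED compact superset of the
archimedean image `archImage W`.  This file DERIVES such a superset from the arithmetic of the plane:

* `IsTotallyDefinite W := IsTotallyReal k ∧ ∀ σ : k →+* ℝ, (W.B.map σ).PosDef ∨ (-(W.B.map σ)).PosDef` — the base field
  is totally real and the trace form `B` is definite at EVERY real place (the tree's `IsDefinite W` asks ONE place).
* the real-matrix fact (`exists_entry_bound_of_posDef`, Mathlib only): the orthogonal group `{P | P S Pᵀ = S}` of a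
  positive definite real `S` is entrywise bounded — `S = M Mᵀ` with `M` invertible (`exists_mul_transpose_eq_of_posDef`:
  the spectral theorem `S = U diag(λ) Uᵀ` with `M = U diag(√λ)`), `Q := M⁻¹ P M` satisfies `Q Qᵀ = 1`, so `Q` is in
  Mathlib's `unitaryGroup` with `|Q a b| ≤ 1` (`entry_norm_bound_of_unitary`), and `P = M Q M⁻¹` has
  `|P i j| ≤ ∑ |M i a| |M⁻¹ b j|`; the `-S` case by `P S Pᵀ = S ↔ P (-S) Pᵀ = -S`.
* at a real place `w`: `realEntry hw : 𝔸_k →+* ℝ` (the `w`-component followed by Mathlib's isometric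
  `extensionEmbeddingOfIsReal`), `realEntry_algebraMap` (a principal adele goes to its real embedding), the real matrix
  `realMat W hw g` of `g ∈ U(W)(𝔸_k)` and the identity `realMat W hw g * B_σ * (realMat W hw g)ᵀ = B_σ`
  (`realMat_mul_B`: the adelic unitary relation `g B gᵀ = B` read through the ring homomorphism), hence a uniform
  entry bound `c w` (`exists_realMat_entry_bound`).
* THEOREM `exists_isCompact_archImage_subset (htot : IsTotallyDefinite W) : ∃ C, IsCompact C ∧ archImage W ⊆ C` —
  `C` is the box `∏_{i j} ∏_w ρ_w⁻¹ [-(c w), c w]` (each factor compact: `ρ_w` is an isometry of the complete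
  `w.Completion` into `ℝ`, hence a closed embedding; Tychonoff), and the entry bounds put every archimedean matrix of
  the group in it.  COROLLARIES: `isCompact_closure_archImage`, **`isCompact_finLevel_of_totallyDefinite`**,
  `isDefinite_of_totallyDefinite`, and on `Setting.ofAdelic` **`exists_spec_of_archCoeff_of_totallyDefinite`**: on a
  totally definite plane the test pairs `(1_{K_f(N γ) × G(k_∞)} · (archMat pl (w γ) ·) (i γ) (j γ), f₂)` have finite
  spectra — (S1b) for the concrete spherical family with the arithmetic hypothesis `IsTotallyDefinite pl` as the ONLY
  display, no analytic binder.

WHAT IS NOT CLAIMED.  That L1's plane `ofLinesRow (cmQuad ω h) a b 1` IS totally definite (its constructors take the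
sign conditions at the distinguished place `τ₀` only — total definiteness is a further condition on `a, b`: totally
positive or totally negative); the seesaw identity (S1a); the dictionary `tf`; (S3′); `P_T4`.  0 print.

JUNK TESTS.  An indefinite place makes `IsTotallyDefinite` false (hyperbolic rotations are unbounded) — the hypothesis
has content; a complex place is excluded by `IsTotallyReal k` (over `ℂ` the orthogonal group of a symmetric form is not
compact).  `N = 0` stays guarded downstream.  `n` empty in the real lemma: `c = 0`, vacuous — harmless.

Nothing here says anything about the status of the Hodge conjecture for CM abelian varieties, which is NOT proved
(HC_CM is NOT proved by anyone in this repository).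
-/

set_option autoImplicit false

noncomputable section

namespace Summit.Ventures.HodgeRepro.Tier4.Line1

open NumberField IsDedekindDomain Common MeasureTheory Topology Matrix

section RealOrthogonal

variable {n : Type} [Fintype n] [DecidableEq n]

/-- a positive definite real matrix is `M * Mᵀ` for an invertible `M` (the spectral theorem with the square roots of
the eigenvalues). -/
theorem exists_mul_transpose_eq_of_posDef {S : Matrix n n ℝ} (hS : S.PosDef) :
    ∃ M : Matrix n n ℝ, M * Mᵀ = S ∧ IsUnit M.det := by
  have hH : S.IsHermitian := hS.1
  set U : Matrix n n ℝ := (hH.eigenvectorUnitary : Matrix n n ℝ) with hU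
  set d : n → ℝ := fun i => Real.sqrt (hH.eigenvalues i) with hd
  have hprod : U * diagonal d * (U * diagonal d)ᵀ = S := by
    have hspec := hH.spectral_theorem
    rw [Unitary.conjStarAlgAut_apply] at hspec
    have hdd : diagonal d * (diagonal d)ᵀ = diagonal (RCLike.ofReal ∘ hH.eigenvalues) := by
      rw [diagonal_transpose, diagonal_mul_diagonal]
      congr 1
      funext i
      simp only [hd, Function.comp_apply, RCLike.ofReal_real_eq_id, id_eq]
      exact Real.mul_self_sqrt (le_of_lt (hS.eigenvalues_pos i))
    have hstar : star U = Uᵀ := by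
      rw [star_eq_conjTranspose, conjTranspose_eq_transpose_of_trivial]
    calc U * diagonal d * (U * diagonal d)ᵀ
        = U * (diagonal d * (diagonal d)ᵀ) * Uᵀ := by
          simp only [transpose_mul, Matrix.mul_assoc]
      _ = U * diagonal (RCLike.ofReal ∘ hH.eigenvalues) * star U := by rw [hdd, hstar]
      _ = S := hspec.symm
  refine ⟨U * diagonal d, hprod, ?_⟩
  have hdet : (U * diagonal d).det * (U * diagonal d).det = S.det := by
    have h := congrArg Matrix.det hprod
    rwa [det_mul, det_transpose] at h
  have hpos : 0 < S.det := hS.det_pos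
  refine isUnit_iff_ne_zero.2 fun h0 => ?_
  rw [h0, zero_mul] at hdet
  exact absurd hdet (ne_of_lt hpos)

/-- **the orthogonal group of a positive definite real form is entrywise bounded**: there is `c` with `|P i j| ≤ c`
for every `P` with `P * S * Pᵀ = S` — conjugating by a square root `M` of `S` lands in the orthogonal group, whose
entries are bounded by `1`. -/
theorem exists_entry_bound_of_posDef {S : Matrix n n ℝ} (hS : S.PosDef) :
    ∃ c : ℝ, ∀ P : Matrix n n ℝ, P * S * Pᵀ = S → ∀ i j, |P i j| ≤ c := by
  obtain ⟨M, hM, hMu⟩ := exists_mul_transpose_eq_of_posDef hS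
  set N : Matrix n n ℝ := M⁻¹ with hN
  have hNM : N * M = 1 := nonsing_inv_mul M hMu
  have hMN : M * N = 1 := mul_nonsing_inv M hMu
  refine ⟨∑ i, ∑ j, ∑ a, ∑ b, |M i a| * |N b j|, fun P hP i j => ?_⟩
  -- the conjugate `Q = N P M` is orthogonal
  set Q : Matrix n n ℝ := N * P * M with hQ
  have hQQ : Q * Qᵀ = 1 := by
    have h1 : Q * Qᵀ = N * (P * S * Pᵀ) * Nᵀ := by
      rw [hQ, ← hM]
      simp only [transpose_mul, Matrix.mul_assoc]
    rw [h1, hP, ← hM]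
    calc N * (M * Mᵀ) * Nᵀ = (N * M) * (N * M)ᵀ := by simp only [transpose_mul, Matrix.mul_assoc]
      _ = 1 := by rw [hNM, transpose_one, one_mul]
  have hQu : Q ∈ Matrix.unitaryGroup n ℝ := by
    rw [mem_unitaryGroup_iff, star_eq_conjTranspose, conjTranspose_eq_transpose_of_trivial]
    exact hQQ
  have hQb : ∀ a b, |Q a b| ≤ 1 := fun a b => by
    have := entry_norm_bound_of_unitary hQu a b
    rwa [Real.norm_eq_abs] at this
  -- `P = M Q N`
  have hPQ : P = M * Q * N := by
    rw [hQ]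
    calc P = (M * N) * P * (M * N) := by rw [hMN, one_mul, mul_one]
      _ = M * (N * P * M) * N := by simp only [Matrix.mul_assoc]
  have hentry : P i j = ∑ b, ∑ a, M i a * Q a b * N b j := by
    rw [hPQ, mul_apply]
    refine Finset.sum_congr rfl fun b _ => ?_
    rw [mul_apply, Finset.sum_mul]
  rw [hentry]
  calc |∑ b, ∑ a, M i a * Q a b * N b j| ≤ ∑ b, ∑ a, |M i a * Q a b * N b j| := by
        refine (Finset.abs_sum_le_sum_abs _ _).trans ?_
        exact Finset.sum_le_sum fun b _ => Finset.abs_sum_le_sum_abs _ _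
    _ ≤ ∑ b, ∑ a, |M i a| * |N b j| := by
        refine Finset.sum_le_sum fun b _ => Finset.sum_le_sum fun a _ => ?_
        rw [abs_mul, abs_mul]
        calc |M i a| * |Q a b| * |N b j| ≤ |M i a| * 1 * |N b j| := by
              gcongr
              exact hQb a b
          _ = |M i a| * |N b j| := by ring
    _ = ∑ a, ∑ b, |M i a| * |N b j| := Finset.sum_comm
    _ ≤ ∑ i, ∑ j, ∑ a, ∑ b, |M i a| * |N b j| := by
        have hnn : ∀ i' j', 0 ≤ ∑ a, ∑ b, |M i' a| * |N b j'| := fun i' j' =>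
          Finset.sum_nonneg fun a _ => Finset.sum_nonneg fun b _ => mul_nonneg (abs_nonneg _) (abs_nonneg _)
        calc ∑ a, ∑ b, |M i a| * |N b j| ≤ ∑ j', ∑ a, ∑ b, |M i a| * |N b j'| :=
              Finset.single_le_sum (f := fun j' => ∑ a, ∑ b, |M i a| * |N b j'|) (fun j' _ => hnn i j')
                (Finset.mem_univ j)
          _ ≤ ∑ i', ∑ j', ∑ a, ∑ b, |M i' a| * |N b j'| :=
              Finset.single_le_sum (f := fun i' => ∑ j', ∑ a, ∑ b, |M i' a| * |N b j'|)
                (fun i' _ => Finset.sum_nonneg fun j' _ => hnn i' j') (Finset.mem_univ i)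

/-- the same bound when `-S` is positive definite (`P S Pᵀ = S ↔ P (-S) Pᵀ = -S`). -/
theorem exists_entry_bound_of_negDef {S : Matrix n n ℝ} (hS : (-S).PosDef) :
    ∃ c : ℝ, ∀ P : Matrix n n ℝ, P * S * Pᵀ = S → ∀ i j, |P i j| ≤ c := by
  obtain ⟨c, hc⟩ := exists_entry_bound_of_posDef hS
  refine ⟨c, fun P hP => hc P ?_⟩
  rw [Matrix.mul_neg, Matrix.neg_mul, hP]

end RealOrthogonal

section RealPlace

variable {k : Type} [Field k] [NumberField k]

/-- **the real entry map at a real place `w`**: `𝔸_k →+* ℝ`, the `w`-component followed by Mathlib's isometric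
`extensionEmbeddingOfIsReal`. -/
def realEntry {w : InfinitePlace k} (hw : w.IsReal) : Ad k →+* ℝ :=
  (InfinitePlace.Completion.extensionEmbeddingOfIsReal hw).comp (adComponentInf k w)

/-- the real entry map is continuous. -/
theorem continuous_realEntry {w : InfinitePlace k} (hw : w.IsReal) : Continuous (realEntry hw) :=
  (InfinitePlace.Completion.isometry_extensionEmbeddingOfIsReal hw).continuous.comp (continuous_adComponentInf k w)

/-- a principal adele goes to its real embedding. -/
theorem realEntry_algebraMap {w : InfinitePlace k} (hw : w.IsReal) (b : k) :
    realEntry hw (algebraMap k (Ad k) b) = InfinitePlace.embedding_of_isReal hw b := by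
  show InfinitePlace.Completion.extensionEmbeddingOfIsReal hw (adComponentInf k w (algebraMap k (Ad k) b)) = _
  have h : adComponentInf k w (algebraMap k (Ad k) b) =
      (((WithAbs.equiv w.1).symm b : WithAbs w.1) : w.Completion) := rfl
  rw [h]
  exact InfinitePlace.Completion.extensionEmbeddingOfIsReal_coe hw _

/-- the real entry map on the archimedean part: `realEntry hw x = ρ_w (infPart x w)` (`rfl`). -/
theorem realEntry_eq {w : InfinitePlace k} (hw : w.IsReal) (x : Ad k) :
    realEntry hw x = InfinitePlace.Completion.extensionEmbeddingOfIsReal hw (infPart k x w) := rfl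

variable (W : PlaneData k)

/-- **the real matrix of `g ∈ U(W)(𝔸_k)` at a real place**. -/
def realMat {w : InfinitePlace k} (hw : w.IsReal) (g : GA W) : Matrix (Fin 4) (Fin 4) ℝ :=
  (GA.mat W g).map (realEntry hw)

/-- the entries of the real matrix (`rfl`). -/
theorem realMat_apply {w : InfinitePlace k} (hw : w.IsReal) (g : GA W) (i j : Fin 4) :
    realMat W hw g i j = InfinitePlace.Completion.extensionEmbeddingOfIsReal hw (infPartMat k (GA.mat W g) i j w) :=
  rfl

/-- the adelic Gram matrix read at a real place is the real Gram matrix `B.map σ_w`. -/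
theorem adMat_map_realEntry {w : InfinitePlace k} (hw : w.IsReal) :
    (adMat k W.B).map (realEntry hw) = W.B.map (InfinitePlace.embedding_of_isReal hw) := by
  unfold adMat
  rw [Matrix.map_map]
  congr 1
  funext x
  exact realEntry_algebraMap hw x

/-- **the real matrix of a unitary element preserves the real Gram matrix**: `P B_σ Pᵀ = B_σ` — the adelic relation
`g B gᵀ = B` read through the ring homomorphism `realEntry`. -/
theorem realMat_mul_B {w : InfinitePlace k} (hw : w.IsReal) (g : GA W) :
    realMat W hw g * W.B.map (InfinitePlace.embedding_of_isReal hw) * (realMat W hw g)ᵀ =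
      W.B.map (InfinitePlace.embedding_of_isReal hw) := by
  have hg : GA.mat W g * adMat k W.B * (GA.mat W g)ᵀ = adMat k W.B := ((mem_unitaryGroup W g).1 g.2).2
  have h := congrArg (fun A : M4 k => A.map (realEntry hw)) hg
  simp only [Matrix.map_mul, Matrix.transpose_map] at h
  rw [adMat_map_realEntry W hw] at h
  exact h

/-- **a uniform entry bound for the real matrices at a definite real place**. -/
theorem exists_realMat_entry_bound {w : InfinitePlace k} (hw : w.IsReal)
    (hdef : (W.B.map (InfinitePlace.embedding_of_isReal hw)).PosDef ∨
      (-(W.B.map (InfinitePlace.embedding_of_isReal hw))).PosDef) :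
    ∃ c : ℝ, ∀ g : GA W, ∀ i j, |realMat W hw g i j| ≤ c := by
  rcases hdef with h | h
  · obtain ⟨c, hc⟩ := exists_entry_bound_of_posDef h
    exact ⟨c, fun g i j => hc _ (realMat_mul_B W hw g) i j⟩
  · obtain ⟨c, hc⟩ := exists_entry_bound_of_negDef h
    exact ⟨c, fun g i j => hc _ (realMat_mul_B W hw g) i j⟩

end RealPlace

section TotallyDefinite

variable {k : Type} [Field k] [NumberField k] (W : PlaneData k)

/-- **a totally definite plane**: the base field is totally real and the trace form is definite at EVERY real place
(the tree's `IsDefinite W` asks one place). -/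
def IsTotallyDefinite : Prop :=
  IsTotallyReal k ∧ ∀ σ : k →+* ℝ, (W.B.map σ).PosDef ∨ (-(W.B.map σ)).PosDef

/-- a totally definite plane is definite (at any real place). -/
theorem isDefinite_of_totallyDefinite (htot : IsTotallyDefinite W) : IsDefinite W := by
  obtain ⟨htr, hdef⟩ := htot
  obtain ⟨w⟩ := (inferInstance : Nonempty (InfinitePlace k))
  exact ⟨InfinitePlace.embedding_of_isReal (htr.isReal w), hdef _⟩

/-- **THE ARCHIMEDEAN IMAGE OF A TOTALLY DEFINITE PLANE IS BOUNDED**: it lies in the compact box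
`∏_{i j} ∏_w ρ_w⁻¹ [-(c w), c w]` (each factor the preimage of a compact interval under the closed embedding `ρ_w` of
the complete `w.Completion` into `ℝ`). -/
theorem exists_isCompact_archImage_subset (htot : IsTotallyDefinite W) :
    ∃ C : Set (Matrix (Fin 4) (Fin 4) (InfiniteAdeleRing k)), IsCompact C ∧ archImage W ⊆ C := by
  obtain ⟨htr, hdef⟩ := htot
  have hw : ∀ w : InfinitePlace k, w.IsReal := htr.isReal
  choose c hc using fun w : InfinitePlace k => exists_realMat_entry_bound W (hw w) (hdef _)
  refine ⟨Set.pi Set.univ fun _ : Fin 4 => Set.pi Set.univ fun _ : Fin 4 => Set.pi Set.univ fun w : InfinitePlace k =>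
    (InfinitePlace.Completion.extensionEmbeddingOfIsReal (hw w)) ⁻¹' Set.Icc (-(c w)) (c w), ?_, ?_⟩
  · refine isCompact_univ_pi fun _ => isCompact_univ_pi fun _ => isCompact_univ_pi fun w => ?_
    exact (InfinitePlace.Completion.isometry_extensionEmbeddingOfIsReal (hw w)).isClosedEmbedding.isCompact_preimage
      isCompact_Icc
  · rintro _ ⟨g, rfl⟩
    refine Set.mem_univ_pi.2 fun i => Set.mem_univ_pi.2 fun j => Set.mem_univ_pi.2 fun w => ?_
    have h := hc w g i j
    rw [realMat_apply, abs_le] at h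
    exact ⟨h.1, h.2⟩

/-- the closure of the archimedean image of a totally definite plane is compact. -/
theorem isCompact_closure_archImage (htot : IsTotallyDefinite W) : IsCompact (closure (archImage W)) := by
  obtain ⟨C, hC, hsub⟩ := exists_isCompact_archImage_subset W htot
  exact hC.closure_of_subset hsub

/-- **`K_f(N) × G(k_∞)` IS COMPACT on a totally definite plane** (`N ≠ 0`). -/
theorem isCompact_finLevel_of_totallyDefinite (htot : IsTotallyDefinite W) {N : ℕ} (hN : N ≠ 0) :
    IsCompact (finLevel W N : Set (GA W)) := by
  obtain ⟨C, hC, hsub⟩ := exists_isCompact_archImage_subset W htot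
  exact isCompact_finLevel_of_subset W hC hsub hN

/-- `1_{K_f(N) × G(k_∞)}` is a test function on a totally definite plane. -/
theorem isTest_indicator_finLevel_of_totallyDefinite (htot : IsTotallyDefinite W) {N : ℕ} (hN : N ≠ 0) :
    RTF.IsTest (Set.indicator (finLevel W N : Set (GA W)) fun _ => (1 : ℂ)) :=
  isTest_indicator_of_compactOpen (finLevel W N) (isCompact_finLevel_of_totallyDefinite W htot hN)
    (isOpen_finLevel W hN)

end TotallyDefinite

section Instance

variable {k : Type} [Field k] [NumberField k] (pl : PlaneData k) (hdef : IsDefinite pl) (hgen : IsGenuineRow pl)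
  [MeasurableSpace (GA pl)] [BorelSpace (GA pl)] (R : RTFData pl) (μ : Measure (GA pl)) [μ.IsHaarMeasure]
  [R.μT.IsHaarMeasure] [R.μT'.IsHaarMeasure] (hT : IsCompact (closure R.DT)) (hT' : IsCompact (closure R.DT'))
  {τ : ℕ → Set (GA pl → ℂ)} {φ : ℕ → GA pl → ℂ} {n : ℕ → ℕ}
  {Form : Type} [AddCommGroup Form] [Module ℂ Form] {A : FormAlgebra Form} {Wt : Witness A}

/-- **(S1b) FOR THE CONCRETE SPHERICAL PAIRS ON A TOTALLY DEFINITE PLANE** (the theorem of record of this file): if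
the plane is totally definite and every first test is `1_{K_f(N γ) × G(k_∞)} · (archMat pl (w γ) ·) (i γ) (j γ)` with
`N γ ≠ 0`, every Hecke choice has a finite spectrum — the only hypothesis beyond the shape of the pairs is the
arithmetic `IsTotallyDefinite pl`. -/
theorem exists_spec_of_archCoeff_of_totallyDefinite (htot : IsTotallyDefinite pl)
    (hB : (Setting.ofAdelic pl hdef hgen R μ hT hT').IsAdaptedONB τ φ n)
    (tf : Wt.Translates → (GA pl → ℂ) × (GA pl → ℂ)) (N : Wt.Translates → ℕ) (hN : ∀ γ, N γ ≠ 0)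
    (w : Wt.Translates → InfinitePlace k) (i j : Wt.Translates → Fin 4)
    (htf : ∀ γ, (tf γ).1 = RTF.coeffFn (archMat pl (w γ)) (i γ) (j γ)
      (Set.indicator (finLevel pl (N γ) : Set (GA pl)) fun _ => (1 : ℂ))) :
    ∃ spec : Wt.Translates → Finset ℕ,
      FiniteSpectrum (Setting.ofAdelic pl hdef hgen R μ hT hT') R.chi R.chi' φ n tf spec :=
  exists_spec_of_archCoeff pl hdef hgen R μ hT hT' hB tf N hN w i j
    (fun γ => Set.indicator (finLevel pl (N γ) : Set (GA pl)) fun _ => (1 : ℂ))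
    (fun γ => isTest_indicator_finLevel_of_totallyDefinite pl htot (hN γ))
    (fun γ => indicator_left_invariant (finLevel pl (N γ))) htf

end Instance

end Summit.Ventures.HodgeRepro.Tier4.Line1

end
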